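import Literature.Analysis.FluidPDE.CompressibleEulerWellPosedness
import Literature.Analysis.FluidPDE.CompressibleEulerImplosionFarFieldBounds
import Literature.Analysis.FunctionSpaces.TorusMollifier
import Mathlib.Analysis.SpecialFunctions.SmoothTransition
import Summits.AtomisticToContinuum.HydrodynamicLimit.Theorems.ImplosionDichotomyTypeOneIsentropy

/-!
# The exterior (far-field) part of the periodic Type-I implosion: smooth torus data with a
# prescribed profile on an annulus, and the isentropic local existence theorem

Helper file for the support item `TypeOneIdealImplosion` (stmt-AtomisticToContinuum-15146) of the
route `ImplosionDichotomy` (`AtomisticToContinuum/HydrodynamicLimit`). Two inputs of the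
transplant of the self-similar implosion to `𝕋³` (Cao-Labora–Gómez-Serrano–Shi–Staffilani,
Rem. 1.5: "the periodic result can be easily deduced from the non-periodic one via finite speed of
propagation"):

* `exists_isentropic_solution_of_lwp` — LOCAL EXISTENCE FOR THE ISENTROPIC SYSTEM from the named
  fact `Literature.Analysis.FluidPDE.CompressibleEulerLocalWellPosedness` (Majda 1984, Thm 2.1, for
  the complete system of the monatomic ideal gas, `ζ ≡ 1`): smooth data `ρ₀ > 0`, `u₀` on `𝕋³`
  launch a classical solution of `IsIsentropicEulerSolution (5/3)` on some `[0, T_b)`, `T_b > 0`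
  (solve the complete system from the isentropic data `ϑ₀ = (3/5)ρ₀^{2/3}`; isentropic data stay
  isentropic, `isentropic_of_isentropic_data`; bridge `isIsentropicEulerSolution_of_ideal_isentropic`);
* `exists_torus_datum` — SMOOTH PERIODIC DATA WITH A PRESCRIBED PROFILE ON AN ANNULUS: given
  `P_ρ > 0`, `P_u` smooth on `ℝ³ ∖ {0}` there are smooth `ρ_D > 0`, `u_D` on `𝕋³` whose lifts
  agree with `P_ρ`, `P_u` on the annulus `1/40 ≤ |y| ≤ 1/5` (plateau cut-off times profile,
  filled by the constant state `(1, 0)`, placed at `0 ∈ 𝕋³` by `Torus.transplant`).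

Folklore; tree tools `Torus.transplant`, `Torus.isSmooth_transplant`,
`Torus.transplant_proj_of_norm_lt` (`TorusMollifier`), Mathlib `Real.smoothTransition`.
-/

noncomputable section

namespace Summit.AtomisticToContinuum.HydrodynamicLimit.Theorems

open Set Filter Topology MeasureTheory Function Metric
open scoped ContDiff
open Literature.MathematicalPhysics.KineticTheory
open Literature.Analysis.FunctionSpaces Literature.Analysis.FunctionSpaces.Torus
open Literature.Analysis.FluidPDE (IsIsentropicEulerSolution CompressibleEulerLocalWellPosedness)
open Literature.Analysis.FluidPDE.CompressibleEuler (EulerEOS IsClassicalEulerSolution)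

/-! ## Local existence for the isentropic system from the named fact -/

/-- **Local classical solutions of the isentropic Euler system on `𝕋³` (`γ = 5/3`)**, from the
local well-posedness of the complete system of the monatomic ideal gas
(`CompressibleEulerLocalWellPosedness`, Majda 1984 Thm 2.1, taken as a hypothesis): smooth data
`ρ₀ > 0`, `u₀` launch a classical isentropic solution on some `[0, T_b)`, `T_b > 0`, with these
data. Proof: solve the complete system (`p = ρϑ`, `e = 3ϑ/2`, i.e. `ζ ≡ 1`) from
`(ρ₀, u₀, ϑ₀ = (3/5)ρ₀^{2/3})` below the density ceiling `max ρ₀ + 1`; the solution stays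
isentropic (`isentropic_of_isentropic_data`) and is then an isentropic solution
(`isIsentropicEulerSolution_of_ideal_isentropic`). [cite: Majda1984, Ch. 2 Thm 2.1] -/
theorem exists_isentropic_solution_of_lwp (hLWP : CompressibleEulerLocalWellPosedness)
    {ρ₀ : T3 → ℝ} {u₀ : T3 → V3} (hρ₀ : IsSmooth ρ₀) (hu₀ : IsSmooth u₀) (hpos : ∀ x, 0 < ρ₀ x) :
    ∃ Tb : ℝ, 0 < Tb ∧ ∃ (ρ : ℝ → T3 → ℝ) (u : ℝ → T3 → V3),
      IsIsentropicEulerSolution (5 / 3) Tb ρ u ∧ ρ 0 = ρ₀ ∧ u 0 = u₀ := by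
  -- the isentropic temperature datum
  set θ₀ : T3 → ℝ := fun x => 3 / 5 * ρ₀ x ^ (2 / 3 : ℝ) with hθ₀
  have hθ₀s : IsSmooth θ₀ := by
    change ContDiff ℝ ∞ fun y => 3 / 5 * ρ₀ (proj y) ^ (2 / 3 : ℝ)
    exact contDiff_const.mul (hρ₀.rpow_const_of_ne fun y => (hpos _).ne')
  have hθ₀pos : ∀ x, 0 < θ₀ x := fun x => mul_pos (by norm_num) (Real.rpow_pos_of_pos (hpos x) _)
  -- a density ceiling
  obtain ⟨M, hM⟩ := (isCompact_univ (X := T3)).exists_bound_of_continuousOn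
    hρ₀.continuous.continuousOn
  have hMle : ∀ x, ρ₀ x < M + 1 := fun x =>
    lt_of_le_of_lt ((le_abs_self _).trans ((Real.norm_eq_abs _).symm.le.trans (hM x (mem_univ _))))
      (by linarith)
  have hρm : 0 < M + 1 := by
    obtain ⟨x⟩ := (inferInstance : Nonempty T3)
    linarith [hpos x, hMle x]
  -- the named fact, `ζ ≡ 1`, `f ≡ 0`
  obtain ⟨hloc, -⟩ := hLWP (fun _ => (1 : ℝ)) (fun _ => (0 : ℝ)) (M + 1) contDiff_const hρm
    (fun r _ => by simp)
  obtain ⟨Tb, hTb, ρ, θ, u, hsol, hρ0, hu0, hθ0, -⟩ :=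
    hloc ρ₀ θ₀ u₀ hρ₀ hθ₀s hu₀ hpos hMle hθ₀pos
  refine ⟨Tb, hTb, ρ, u, ?_, hρ0, hu0⟩
  have hiso := isentropic_of_isentropic_data (K := 3 / 5) hsol fun x => by
    rw [hθ0, hρ0]
  exact isIsentropicEulerSolution_of_ideal_isentropic hsol hiso

/-! ## Plateau cut-offs on `ℝ³` -/

/-- **An annular plateau cut-off**: smooth `η : ℝ³ → [0, 1]`, `η = 0` on `|y| ≤ 1/64` and on
`|y| ≥ 9/40`, `η = 1` on `1/40 ≤ |y| ≤ 1/5`. [folklore] -/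
theorem exists_annular_plateau :
    ∃ η : V3 → ℝ, ContDiff ℝ ∞ η ∧ (∀ y, ‖y‖ ≤ 1 / 64 → η y = 0) ∧ (∀ y, 9 / 40 ≤ ‖y‖ → η y = 0) ∧
      (∀ y, 1 / 40 ≤ ‖y‖ → ‖y‖ ≤ 1 / 5 → η y = 1) ∧ (∀ y, 0 ≤ η y ∧ η y ≤ 1) := by
  obtain ⟨χ₁, hχ₁, h₁0, h₁1, h₁b⟩ :=
    Literature.Analysis.FluidPDE.CaolaboraEtAl2025.exists_radial_cutoff (a := 1 / 64) (b := 1 / 40)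
      (by norm_num) (by norm_num)
  obtain ⟨χ₂, hχ₂, h₂0, h₂1, h₂b⟩ :=
    Literature.Analysis.FluidPDE.CaolaboraEtAl2025.exists_radial_cutoff (a := 1 / 5) (b := 9 / 40)
      (by norm_num) (by norm_num)
  refine ⟨fun y => χ₁ y * (1 - χ₂ y), hχ₁.mul (contDiff_const.sub hχ₂), fun y hy => ?_,
    fun y hy => ?_, fun y hy1 hy2 => ?_, fun y => ?_⟩
  · simp only [h₁0 y hy, zero_mul]
  · simp only [h₂1 y hy, sub_self, mul_zero]
  · simp only [h₁1 y hy1, h₂0 y hy2]; norm_num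
  · obtain ⟨a1, a2⟩ := h₁b y
    obtain ⟨b1, b2⟩ := h₂b y
    exact ⟨mul_nonneg a1 (by linarith), mul_le_one₀ a2 (by linarith) (by linarith)⟩

/-- A product `η · g` with `η` smooth and vanishing on a ball around `0`, and `g` smooth off the
origin, is smooth on `ℝ³`. [folklore] -/
theorem contDiff_plateau_smul {G : Type*} [NormedAddCommGroup G] [NormedSpace ℝ G]
    {η : V3 → ℝ} (hη : ContDiff ℝ ∞ η) {δ : ℝ} (hδ : 0 < δ) (hη0 : ∀ y, ‖y‖ ≤ δ → η y = 0)
    {g : V3 → G} (hg : ∀ y : V3, y ≠ 0 → ContDiffAt ℝ ∞ g y) :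
    ContDiff ℝ ∞ fun y => η y • g y := by
  refine contDiff_iff_contDiffAt.2 fun y => ?_
  by_cases hy : y = 0
  · have hev : (fun y => η y • g y) =ᶠ[𝓝 y] fun _ => 0 := by
      have h1 : ∀ᶠ y' : V3 in 𝓝 y, ‖y'‖ < δ :=
        continuous_norm.continuousAt.eventually (gt_mem_nhds (show ‖y‖ < δ by rw [hy, norm_zero]; exact hδ))
      filter_upwards [h1] with y' hy'
      rw [hη0 y' hy'.le, zero_smul]
    exact (contDiffAt_const (c := (0 : G))).congr_of_eventuallyEq hev
  · exact hη.contDiffAt.smul (hg y hy)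

/-! ## Smooth periodic data with a prescribed profile on an annulus -/

/-- **Smooth data on `𝕋³` with a prescribed state on an annulus around `0`.** Let `P_ρ > 0` and
`P_u` be smooth on `ℝ³ ∖ {0}` (e.g. the terminal far-field state of the self-similar
implosion, `∝ |y|^{3(1−r)}` and `∝ |y|^{−r}y`). Then there are smooth `ρ_D > 0` and `u_D` on the
unit torus such that `ρ_D(proj y) = P_ρ(y)` and `u_D(proj y) = P_u(y)` for `1/40 ≤ |y| ≤ 1/5`.
Construction: `1 + transplant(η(P_ρ − 1))`, `transplant(η P_u)` with the annular plateau `η`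
(support in `B(0, 1/4)`, where `Torus.transplant` is a faithful copy). [folklore] -/
theorem exists_torus_datum {Pρ : V3 → ℝ} {Pu : V3 → V3}
    (hPρ : ∀ y : V3, y ≠ 0 → ContDiffAt ℝ ∞ Pρ y) (hPu : ∀ y : V3, y ≠ 0 → ContDiffAt ℝ ∞ Pu y)
    (hpos : ∀ y : V3, y ≠ 0 → 0 < Pρ y) :
    ∃ (ρD : T3 → ℝ) (uD : T3 → V3), IsSmooth ρD ∧ IsSmooth uD ∧ (∀ x, 0 < ρD x) ∧
      ∀ y : V3, 1 / 40 ≤ ‖y‖ → ‖y‖ ≤ 1 / 5 → ρD (proj y) = Pρ y ∧ uD (proj y) = Pu y := by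
  obtain ⟨η, hη, hη0, hη9, hη1, hηb⟩ := exists_annular_plateau
  have hδ : (0 : ℝ) < 1 / 64 := by norm_num
  set gρ : V3 → ℝ := fun y => η y • (Pρ y - 1) with hgρ
  set gu : V3 → V3 := fun y => η y • Pu y with hgu
  have hgρs : ContDiff ℝ ∞ gρ :=
    contDiff_plateau_smul hη hδ hη0 fun y hy => (hPρ y hy).sub contDiffAt_const
  have hgus : ContDiff ℝ ∞ gu := contDiff_plateau_smul hη hδ hη0 hPu
  have hsuppρ : support gρ ⊆ ball 0 (1 / 4) := by
    intro y hy
    rw [mem_ball_zero_iff]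
    by_contra h
    exact hy (by simp only [hgρ, hη9 y (by linarith [not_lt.1 h]), zero_smul])
  have hsuppu : support gu ⊆ ball 0 (1 / 4) := by
    intro y hy
    rw [mem_ball_zero_iff]
    by_contra h
    exact hy (by simp only [hgu, hη9 y (by linarith [not_lt.1 h]), zero_smul])
  refine ⟨fun x => 1 + transplant gρ x, transplant gu, ?_, isSmooth_transplant hgus hsuppu,
    fun x => ?_, fun y hy1 hy2 => ?_⟩
  · have h := isSmooth_transplant hgρs hsuppρ
    change ContDiff ℝ ∞ fun y => 1 + lift (transplant gρ) y
    exact contDiff_const.add h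
  · -- positivity: `1 + η(P − 1) = (1 − η) + ηP > 0`
    simp only [transplant_apply, hgρ, smul_eq_mul]
    set w := reprc x
    obtain ⟨h0, h1⟩ := hηb w
    by_cases hw : η w = 0
    · rw [hw]; norm_num
    · have hw0 : w ≠ 0 := by
        intro h; apply hw; exact hη0 w (by rw [h, norm_zero]; norm_num)
      have hP := hpos w hw0
      have hηpos : 0 < η w := lt_of_le_of_ne h0 (Ne.symm hw)
      nlinarith [mul_pos hηpos hP]
  · have hy : ‖y‖ < 1 / 2 := by linarith
    have hηy : η y = 1 := hη1 y hy1 hy2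
    refine ⟨?_, ?_⟩
    · show 1 + transplant gρ (proj y) = Pρ y
      rw [transplant_proj_of_norm_lt _ hy]
      simp only [hgρ, hηy, one_smul]; ring
    · rw [transplant_proj_of_norm_lt _ hy]
      simp only [hgu, hηy, one_smul]

end Summit.AtomisticToContinuum.HydrodynamicLimit.Theorems

end
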